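import Mathlib
import Summits.Ventures.HodgeRepro.Tier4.Common.RowWeights

/-!
# Tier4/Common/IsCMAtOfConj — `IsCMAt q w` AT EVERY INFINITE PLACE of the maximal real subfield of a CM field, from a
root `ω` of `X² − t X + n` moved by complex conjugation

Blind re-derivation cell `pub-hodge-repro`, Tier 4 «prove the step» (README §9–§10), seat t4-typer-2 (gen 4), on
t4-plan-4 g4's cut S14946 (C)(1) (display (9) `l4_isCMAt` of Skeleton v0.33: «at a real `w` with `t_w² ≥ 4 n_w` the
quadratic has a real root, so `σ̃(ω) ∈ ℝ` for any embedding extending `w`; `IsCMField`'s conjugation commutes with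
embeddings ⇒ `σ̃(c ω) = σ̃ ω` ⇒ `c ω = ω`, against `DescribesCM`'s `c(ω) ≠ ω`»).  Target tree path
`lean/Summits/Ventures/HodgeRepro/Tier4/Common/IsCMAtOfConj.lean`.  Imports: Mathlib + `Common.RowWeights` (`tAt`,
`nAt`, `IsCMAt`, `tAt_eq_re`, `nAt_eq_re`).

THE ARGUMENT.  `k := maximalRealSubfield E` is totally real (Mathlib `IsTotallyReal`), so every infinite place `w` of `k`
is real and `t_w = w.embedding q.t`, `n_w = w.embedding q.n` are real numbers (`tAt_eq_embedding`, `nAt_eq_embedding`).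
Lift `w.embedding` to `σ : E →+* ℂ` (Mathlib `ComplexEmbedding.lift`, `E/k` algebraic); `z := σ ω` satisfies
`z² = t_w z − n_w`.  If `t_w² ≥ 4 n_w` then `z` is REAL (`im z · (2 re z − t_w) = 0`, and `re z = t_w/2` forces
`(im z)² = n_w − t_w²/4 ≤ 0`), so `σ (c ω) = conj (σ ω) = σ ω` (`IsCMField.complexEmbedding_complexConj`) and
`c ω = ω` by injectivity of `σ` — against `c ω ≠ ω`.  Hence `t_w² < 4 n_w`: **`isCMAt_of_conj_ne`**, and the
`∀ w` form **`forall_isCMAt_of_conj_ne`** = the skeleton's display (9) with `DescribesCM q` unpacked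
(`l4_isCMAt q hq := let ⟨ω, hω, _, hne⟩ := hq; forall_isCMAt_of_conj_ne q ω hω hne`; the clause `c ω = t − ω` is
not needed).  Also `real_of_sq_eq_of_disc_nonpos` (the real-root lemma) and `isReal_infinitePlace_maximalRealSubfield`.

Nothing here says anything about the status of the Hodge conjecture for CM abelian varieties, which is NOT proved
(HC_CM is NOT proved by anyone in this repository).
-/

set_option autoImplicit false

noncomputable section

namespace Summit.Ventures.HodgeRepro.Tier4.Common

open NumberField
open scoped ComplexConjugate

section Embedding

variable {k : Type} [Field k] [NumberField k]

omit [NumberField k] in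
/-- `t_w` is the embedding of `q.t` at `w`. -/
theorem tAt_eq_embedding (q : QuadData k) (w : InfinitePlace k) : tAt q w = w.embedding q.t :=
  InfinitePlace.Completion.extensionEmbedding_coe w ((WithAbs.equiv w.1).symm q.t)

omit [NumberField k] in
/-- `n_w` is the embedding of `q.n` at `w`. -/
theorem nAt_eq_embedding (q : QuadData k) (w : InfinitePlace k) : nAt q w = w.embedding q.n :=
  InfinitePlace.Completion.extensionEmbedding_coe w ((WithAbs.equiv w.1).symm q.n)

end Embedding

section RealRoot

/-- **A root of `X² − T X + N` with `T, N` real and `T² ≥ 4 N` is real**: `im z · (2 re z − T) = 0`, and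
`re z = T/2` forces `(im z)² = N − T²/4 ≤ 0`. -/
theorem real_of_sq_eq_of_disc_nonpos {T N : ℝ} {z : ℂ} (hz : z ^ 2 = (T : ℂ) * z - (N : ℂ)) (hD : 4 * N ≤ T ^ 2) :
    z.im = 0 := by
  have hre := congrArg Complex.re hz
  have him := congrArg Complex.im hz
  simp only [sq, Complex.mul_re, Complex.mul_im, Complex.sub_re, Complex.sub_im, Complex.ofReal_re,
    Complex.ofReal_im, zero_mul, sub_zero, add_zero] at hre him
  -- `him : 2 a b = T b`, `hre : a² − b² = T a − N`
  have h2 : z.im * (2 * z.re - T) = 0 := by linear_combination him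
  rcases mul_eq_zero.1 h2 with hb | ha
  · exact hb
  · have hsq : z.im ^ 2 ≤ 0 := by nlinarith [sq_nonneg z.im]
    exact pow_eq_zero_iff (n := 2) two_ne_zero |>.1 (le_antisymm hsq (sq_nonneg _))

end RealRoot

section CM

variable {E : Type} [Field E] [NumberField E] [IsCMField E]

omit [IsCMField E] in
/-- Every infinite place of the maximal real subfield of a CM field is real (Mathlib `IsTotallyReal`). -/
theorem isReal_infinitePlace_maximalRealSubfield (w : InfinitePlace (↥(maximalRealSubfield E))) : w.IsReal :=
  IsTotallyReal.isReal w

/-- **`IsCMAt q w` at a place `w` of `k = E⁺` from a root `ω ∈ E` of `X² − t X + n` moved by the complex conjugation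
of the CM field `E`.** -/
theorem isCMAt_of_conj_ne (q : QuadData (↥(maximalRealSubfield E))) (ω : E)
    (hω : ω ^ 2 = algebraMap (↥(maximalRealSubfield E)) E q.t * ω - algebraMap (↥(maximalRealSubfield E)) E q.n)
    (hne : IsCMField.complexConj E ω ≠ ω) (w : InfinitePlace (↥(maximalRealSubfield E))) : IsCMAt q w := by
  have hw : w.IsReal := isReal_infinitePlace_maximalRealSubfield w
  -- the lift of `w.embedding` to `E`
  set σ : E →+* ℂ := ComplexEmbedding.lift E w.embedding with hσdef
  have hσ : ∀ x : ↥(maximalRealSubfield E), σ (algebraMap (↥(maximalRealSubfield E)) E x) = w.embedding x :=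
    fun x => ComplexEmbedding.lift_algebraMap_apply E w.embedding x
  -- `z := σ ω` is a root of `X² − t_w X + n_w`
  have hz : (σ ω) ^ 2 = tAt q w * σ ω - nAt q w := by
    have h := congrArg σ hω
    simp only [map_pow, map_sub, map_mul, hσ] at h
    rw [tAt_eq_embedding, nAt_eq_embedding]
    exact h
  -- `t_w`, `n_w` are real numbers
  have ht : tAt q w = ((tAt q w).re : ℂ) := tAt_eq_re hw
  have hn : nAt q w = ((nAt q w).re : ℂ) := nAt_eq_re hw
  unfold IsCMAt
  by_contra hcon
  have hD : 4 * (nAt q w).re ≤ (tAt q w).re ^ 2 := le_of_not_gt hcon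
  -- then `σ ω` is real, so conjugation fixes it
  have hzre : (σ ω).im = 0 := by
    refine real_of_sq_eq_of_disc_nonpos (T := (tAt q w).re) (N := (nAt q w).re) ?_ hD
    rw [← ht, ← hn]
    exact hz
  have hconj : σ (IsCMField.complexConj E ω) = σ ω := by
    rw [IsCMField.complexEmbedding_complexConj]
    exact Complex.conj_eq_iff_im.2 hzre
  exact hne (σ.injective hconj)

/-- **The skeleton's display (9)**: `IsCMAt q w` at EVERY infinite place of `E⁺` (`DescribesCM q` unpacked; the clause
`c ω = t − ω` is not needed). -/
theorem forall_isCMAt_of_conj_ne (q : QuadData (↥(maximalRealSubfield E))) (ω : E)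
    (hω : ω ^ 2 = algebraMap (↥(maximalRealSubfield E)) E q.t * ω - algebraMap (↥(maximalRealSubfield E)) E q.n)
    (hne : IsCMField.complexConj E ω ≠ ω) : ∀ w : InfinitePlace (↥(maximalRealSubfield E)), IsCMAt q w :=
  fun w => isCMAt_of_conj_ne q ω hω hne w

end CM

end Summit.Ventures.HodgeRepro.Tier4.Common

end
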